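import Summits.SmoothPoincare4.SmoothPoincare4.Theses.SymplecticOrigami
import Literature.Topology.FourManifolds.Morse
import Literature.Topology.FourManifolds.MorseTwoCriticalPoints
import Literature.Topology.FourManifolds.TraceMorseFunction
import Literature.Topology.FourManifolds.CircleNbhdTransport
import Literature.Topology.FourManifolds.LatticeFormsDefinite

/-!
# Stub `stub_ballOfSublevel` of line `pair-rigidity-endgame` (crux `SymplecticOrigami.OrigamiRung`)

**A compact regular sublevel set around a single non-degenerate minimum is an embedded closed
ball.**  Let `f` be smooth on an open set `Ω` of a boundaryless `4`-manifold `M`, with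
`{x ∈ Ω | f x ≤ 0}` compact, and let `p ∈ Ω`, `f p < 0`, be the only critical point of `f` in
`{f ≤ 0}`, with positive definite Hessian.  Then there is a smooth embedding `j : 𝔻⁴ → M` of the
closed unit ball (manifold with boundary, `ClosedBall.lean`) with `j(𝔻⁴) = {x ∈ Ω | f x ≤ 0}`
and `j(∂𝔻⁴) = {x ∈ Ω | f x = 0}` (Milnor, *Morse theory* (1963), Thm. 3.1 with the Lemma of
Morse, as in the proof of Reeb's Thm. 4.1, p. 25: "`Mᵃ` is a closed `n`-cell").

The proof is plumbing over proved tree machinery: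

* `isOpen_setOf_not_isMCriticalPt_and_le` — the critical set of `f|Ω` is closed in `Ω`
  (`isClosed_criticalSet_of_contMDiff`), so removing from `Ω` the critical points with `0 ≤ f`
  leaves an open set `U ⊇ {f ≤ 0}` on which `p` is the only critical point; on the open
  submanifold `U` (Mathlib's `TopologicalSpace.Opens` instances) `g = f|U` is therefore a Morse
  function (criticality and Hessians transfer, `isMCriticalPt_comp_subtype_val_opens_iff`,
  `mhessian_comp_subtype_val_opens`; positive definite forms are nondegenerate) and `0` is a
  regular level of `g` (`isRegularLevel_of_not_isMCriticalPt`);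
* the regular sublevel set `RegularSublevel h = {g ≤ 0}` (`RegularLevelSplitting.lean`: a compact
  manifold with boundary `{g = 0}`, smoothly embedded in `U` by the inclusion) carries the adapted
  Morse function `g + 1` of `RegularSublevel.morseData`, whose only critical point is `p`, of
  index `sigNeg (Hess f p) = 0` (`LinearMap.BilinForm.sigNeg_eq_zero_of_posDef`), so the disc
  lemma `IsMorseAdapted.nonempty_diffeomorph_closedBall` gives `Φ : {g ≤ 0} ≅ 𝔻⁴`;
* `j = (U ↪ M) ∘ ({g ≤ 0} ↪ U) ∘ Φ⁻¹` is a smooth embedding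
  (`Manifold.IsSmoothEmbedding.comp_diffeomorph`, `Manifold.IsSmoothEmbedding.subtypeVal_comp`)
  onto `{f ≤ 0}`, and `Φ⁻¹` carries `∂𝔻⁴ = 𝕊³` (`range_inclusion_eq_boundary`) onto
  `∂{g ≤ 0} = {g = 0}` (`Diffeomorph.image_boundary`, `RegularSublevel.mem_boundary_iff`).
-/

noncomputable section

-- the prescribed namespace `Summit.<P>.<Sub>.…` duplicates `SmoothPoincare4` (P = Sub)
set_option linter.dupNamespace false

open scoped Manifold ContDiff Topology ContinuousMap
open Set TopologicalSpace
open Literature.Topology.FourManifolds (singularHomologyZ sphereInversion IsTwistedSphere)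
open Literature.Geometry.Kaehler (MForm IsSmoothForm IsClosedForm)

namespace Summit.SmoothPoincare4.SmoothPoincare4.Theorems.OrigamiRung.PairRigidityEndgame

/-- Model space `ℝⁿ`. -/
local notation "𝔼" n:arg => EuclideanSpace ℝ (Fin n)
/-- The round 4-sphere. -/
local notation "𝕊⁴" => (Metric.sphere (0 : EuclideanSpace ℝ (Fin 5)) 1)
/-- The round 2-sphere. -/
local notation "𝕊²" => (Metric.sphere (0 : EuclideanSpace ℝ (Fin 3)) 1)
/-- The closed unit 4-ball with its manifold-with-boundary structure (`ClosedBall.lean`). -/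
local notation "𝔻⁴" => (Metric.closedBall (0 : EuclideanSpace ℝ (Fin (3 + 1))) 1)

section BallOfSublevel

open Literature.Topology.FourManifolds

/-! ### Removing the critical points above a level leaves an open set -/

/-- **The critical points of a smooth function on an open set with value `≥ a` form a
relatively closed set**: for `f` smooth on the open set `Ω`, the set of points of `Ω` which are
not critical points of `f` with `a ≤ f` is open (the critical set of `f|Ω` is closed in the open
submanifold `Ω`, Milnor 1963, §2, `isClosed_criticalSet_of_contMDiff`; criticality of `f|Ω`
is criticality of `f`, `isMCriticalPt_comp_subtype_val_opens_iff`). [folklore] -/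
theorem isOpen_setOf_not_isMCriticalPt_and_le {E H : Type*} [NormedAddCommGroup E]
    [NormedSpace ℝ E] [TopologicalSpace H] (I : ModelWithCorners ℝ E H) {M : Type*}
    [TopologicalSpace M] [ChartedSpace H M] [IsManifold I ∞ M] {Ω : Set M} {f : M → ℝ}
    (hΩ : IsOpen Ω) (hf : ContMDiffOn I 𝓘(ℝ, ℝ) ∞ f Ω) (a : ℝ) :
    IsOpen {x | x ∈ Ω ∧ ¬ (mfderiv I 𝓘(ℝ, ℝ) f x = 0 ∧ a ≤ f x)} := by
  have hmd : ∀ x ∈ Ω, MDifferentiableAt I 𝓘(ℝ, ℝ) f x := fun x hx =>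
    (hf.contMDiffAt (hΩ.mem_nhds hx)).mdifferentiableAt (by simp)
  set Ω' : Opens M := ⟨Ω, hΩ⟩ with hΩ'
  have hf₀ : ContMDiff I 𝓘(ℝ, ℝ) ∞ (f ∘ (Subtype.val : Ω' → M)) :=
    hf.comp_contMDiff contMDiff_subtype_val fun x => x.2
  have hC : IsClosed (criticalSet I (f ∘ (Subtype.val : Ω' → M))) :=
    isClosed_criticalSet_of_contMDiff hf₀ (by norm_cast)
  have hA : IsClosed (criticalSet I (f ∘ (Subtype.val : Ω' → M)) ∩
      (f ∘ (Subtype.val : Ω' → M)) ⁻¹' Ici a) :=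
    hC.inter (isClosed_Ici.preimage hf₀.continuous)
  have himg : Subtype.val '' (criticalSet I (f ∘ (Subtype.val : Ω' → M)) ∩
      (f ∘ (Subtype.val : Ω' → M)) ⁻¹' Ici a)ᶜ =
      {x | x ∈ Ω ∧ ¬ (mfderiv I 𝓘(ℝ, ℝ) f x = 0 ∧ a ≤ f x)} := by
    ext x
    simp only [mem_image, mem_compl_iff, mem_inter_iff, mem_criticalSet, mem_preimage,
      Function.comp_apply, mem_Ici, mem_setOf_eq]
    constructor
    · rintro ⟨y, hy, rfl⟩
      refine ⟨y.2, fun h => hy ⟨?_, h.2⟩⟩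
      exact (isMCriticalPt_comp_subtype_val_opens_iff y (hmd y y.2)).2 h.1
    · rintro ⟨hx, h⟩
      refine ⟨⟨x, hx⟩, fun hy => h ⟨?_, hy.2⟩, rfl⟩
      exact (isMCriticalPt_comp_subtype_val_opens_iff (⟨x, hx⟩ : Ω') (hmd x hx)).1 hy.1
  rw [← himg]
  exact hΩ.isOpenMap_subtype_val _ hA.isOpen_compl

/-- A bilinear form whose quadratic form is positive definite is nondegenerate. [folklore] -/
theorem nondegenerate_of_posDef_toQuadraticMap {V : Type*} [AddCommGroup V] [Module ℝ V]
    {B : LinearMap.BilinForm ℝ V} (hB : B.toQuadraticMap.PosDef) : B.Nondegenerate := by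
  refine ⟨fun x hx => ?_, fun y hy => ?_⟩
  · by_contra hne
    have h := hB x hne
    rw [LinearMap.BilinMap.toQuadraticMap_apply, hx x] at h
    exact lt_irrefl _ h
  · by_contra hne
    have h := hB y hne
    rw [LinearMap.BilinMap.toQuadraticMap_apply, hy y] at h
    exact lt_irrefl _ h

/-! ### The stub -/

/-- **A compact regular sublevel set around a single non-degenerate minimum is an embedded
closed `4`-ball with boundary sphere onto the level.**  For `f` smooth on an open set `Ω` of a
boundaryless `4`-manifold with `{x ∈ Ω | f x ≤ 0}` compact, whose only critical point in
`{f ≤ 0}` is a point `p` with `f p < 0` and positive definite Hessian, there is a smooth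
embedding `j : 𝔻⁴ → M` with `j(𝔻⁴) = {x ∈ Ω | f x ≤ 0}` and `j(𝕊³) = {x ∈ Ω | f x = 0}`:
shrink `Ω` to an open `U ⊇ {f ≤ 0}` on which `p` is the only critical point, so that `f|U` is
Morse with regular level `0`; the compact regular sublevel set `{f|U ≤ 0}` (a manifold with
boundary `{f = 0}`, Milnor 1963 Thm. 3.1) carries an adapted Morse function with the single
critical point `p`, of index `0`, hence is a disc (Lemma of Morse and Thm. 3.1, as in the proof
of Thm. 4.1); compose the diffeomorphism with the inclusions and transport the boundary.
[cite: Milnor1963, Thm. 3.1, Lemma 2.2 and proof of Thm. 4.1 (p. 25)] -/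
theorem stub_ballOfSublevel :
    ∀ (M : Type) [TopologicalSpace M] [T2Space M] [SecondCountableTopology M]
      [ChartedSpace (𝔼 4) M] [IsManifold (𝓡 4) ∞ M] (Ω : Set M) (f : M → ℝ) (p : M),
      IsOpen Ω → ContMDiffOn (𝓡 4) 𝓘(ℝ, ℝ) ∞ f Ω → IsCompact {x | x ∈ Ω ∧ f x ≤ 0} →
      p ∈ Ω → f p < 0 →
      (∀ x ∈ Ω, f x ≤ 0 → mfderiv (𝓡 4) 𝓘(ℝ, ℝ) f x = 0 → x = p) →
      mfderiv (𝓡 4) 𝓘(ℝ, ℝ) f p = 0 →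
      (Literature.Topology.FourManifolds.mhessian (𝓡 4) f p).toQuadraticMap.PosDef →
      ∃ j : 𝔻⁴ → M, Manifold.IsSmoothEmbedding (𝓡∂ (3 + 1)) (𝓡 (3 + 1)) ∞ j ∧
        Set.range j = {x | x ∈ Ω ∧ f x ≤ 0} ∧
        Set.range (j ∘ Set.inclusion (Metric.sphere_subset_closedBall :
            Metric.sphere (0 : EuclideanSpace ℝ (Fin (3 + 1))) 1 ⊆ Metric.closedBall 0 1)) =
          {x | x ∈ Ω ∧ f x = 0} := by
  intro M _ _ _ _ _ Ω f p hΩ hf hK hpΩ hfp huniq hdfp hH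
  have hmd : ∀ x ∈ Ω, MDifferentiableAt (𝓡 4) 𝓘(ℝ, ℝ) f x := fun x hx =>
    (hf.contMDiffAt (hΩ.mem_nhds hx)).mdifferentiableAt (by simp)
  -- the open set `U ⊇ {f ≤ 0}` on which `p` is the only critical point
  set U : Opens M :=
    ⟨{x | x ∈ Ω ∧ ¬ (mfderiv (𝓡 4) 𝓘(ℝ, ℝ) f x = 0 ∧ 0 ≤ f x)},
      isOpen_setOf_not_isMCriticalPt_and_le (𝓡 4) hΩ hf 0⟩ with hU
  have hUmem : ∀ x, x ∈ U ↔ x ∈ Ω ∧ ¬ (mfderiv (𝓡 4) 𝓘(ℝ, ℝ) f x = 0 ∧ 0 ≤ f x) :=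
    fun x => Iff.rfl
  have hUΩ : ∀ x, x ∈ U → x ∈ Ω := fun x hx => ((hUmem x).1 hx).1
  have hKU : ∀ x, x ∈ Ω → f x ≤ 0 → x ∈ U := by
    intro x hx hfx
    refine (hUmem x).2 ⟨hx, fun h => ?_⟩
    have hxp : x = p := huniq x hx hfx h.1
    rw [hxp] at h
    exact absurd hfp (not_lt.2 h.2)
  have hpU : p ∈ U := hKU p hpΩ hfp.le
  have hcritU : ∀ x, x ∈ U → mfderiv (𝓡 4) 𝓘(ℝ, ℝ) f x = 0 → x = p := by
    intro x hx hc
    obtain ⟨hxΩ, hn⟩ := (hUmem x).1 hx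
    exact huniq x hxΩ (le_of_lt (not_le.1 fun h => hn ⟨hc, h⟩)) hc
  -- `g = f|U` is a Morse function with the single critical point `p` and regular level `0`
  set g : U → ℝ := f ∘ Subtype.val with hg_def
  have hgs : ContMDiff (𝓡 4) 𝓘(ℝ, ℝ) ∞ g := hf.comp_contMDiff contMDiff_subtype_val fun x => hUΩ x x.2
  have hgcrit : ∀ y : U, IsMCriticalPt (𝓡 4) g y → (y : M) = p := fun y hy =>
    hcritU y y.2 ((isMCriticalPt_comp_subtype_val_opens_iff y (hmd y (hUΩ y y.2))).1 hy)
  have hnd : (mhessian (𝓡 4) f p).Nondegenerate := nondegenerate_of_posDef_toQuadraticMap hH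
  have hg : IsMorse (𝓡 4) g := by
    refine ⟨hgs, fun y hy => ?_⟩
    rw [hg_def, mhessian_comp_subtype_val_opens, hgcrit y hy]
    exact hnd
  have h : IsRegularLevel (𝓡 4) g 0 := by
    refine isRegularLevel_of_not_isMCriticalPt hgs fun y hy0 hyc => ?_
    have hyp : (y : M) = p := hgcrit y hyc
    have : f p = 0 := by rw [← hyp]; exact hy0
    exact hfp.ne this
  -- the regular sublevel set `{g ≤ 0}` is compact
  have hKc : IsCompact ((Subtype.val : U → M) ⁻¹' {x | x ∈ Ω ∧ f x ≤ 0}) :=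
    Topology.IsInducing.subtypeVal.isCompact_preimage' hK fun x hx => ⟨⟨x, hKU x hx.1 hx.2⟩, rfl⟩
  have hpre : ((Subtype.val : U → M) ⁻¹' {x | x ∈ Ω ∧ f x ≤ 0}) = g ⁻¹' Iic 0 := by
    ext y
    simp only [mem_preimage, mem_setOf_eq, mem_Iic, hg_def, Function.comp_apply]
    exact ⟨fun hy => hy.2, fun hy => ⟨hUΩ y y.2, hy⟩⟩
  haveI : CompactSpace (RegularSublevel h) := isCompact_iff_compactSpace.1 (hpre ▸ hKc)
  -- Morse data on `{g ≤ 0}`: the adapted Morse function `g + 1`, single critical point `p`, index `0`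
  obtain ⟨hFa, hFcrit, hFind⟩ := RegularSublevel.morseData hg h
  have hpc : IsMCriticalPt (𝓡 4) g ⟨p, hpU⟩ :=
    (isMCriticalPt_comp_subtype_val_opens_iff (⟨p, hpU⟩ : U) (hmd p hpΩ)).2 hdfp
  set P : RegularSublevel h := RegularSublevel.mk h ⟨p, hpU⟩ hfp.le with hP
  have hPc : IsMCriticalPt (𝓡∂ 4)
      (fun x : RegularSublevel h => g (RegularSublevel.incl h x) + (1 - 0)) P :=
    (hFcrit P).2 hpc
  have huniq' : ∀ x : RegularSublevel h, IsMCriticalPt (𝓡∂ 4)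
      (fun x : RegularSublevel h => g (RegularSublevel.incl h x) + (1 - 0)) x → x = P := by
    intro x hx
    have hxc : IsMCriticalPt (𝓡 4) g (RegularSublevel.incl h x) := (hFcrit x).1 hx
    have hxp : ((RegularSublevel.incl h x : U) : M) = p := hgcrit _ hxc
    exact RegularSublevel.injective_incl h (Subtype.ext hxp)
  have h0 : morseIndex (𝓡∂ 4)
      (fun x : RegularSublevel h => g (RegularSublevel.incl h x) + (1 - 0)) P = 0 := by
    rw [hFind P hpc]
    show morseIndex (𝓡 4) (f ∘ Subtype.val) (⟨p, hpU⟩ : U) = 0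
    rw [morseIndex_comp_subtype_val_opens]
    exact LinearMap.BilinForm.sigNeg_eq_zero_of_posDef hH
  obtain ⟨Φ⟩ := hFa.nonempty_diffeomorph_closedBall (k := 3) (by norm_num) hPc huniq' h0
  -- the embedding `j = (U ↪ M) ∘ ({g ≤ 0} ↪ U) ∘ Φ⁻¹`
  have hemb : Manifold.IsSmoothEmbedding (𝓡∂ (3 + 1)) (𝓡 (3 + 1)) ∞
      (Subtype.val ∘ (RegularSublevel.incl h ∘ Φ.symm)) :=
    ((RegularSublevel.isSmoothEmbedding_incl h).comp_diffeomorph Φ.symm).subtypeVal_comp U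
  refine ⟨Subtype.val ∘ (RegularSublevel.incl h ∘ Φ.symm), hemb, ?_, ?_⟩
  · -- `j(𝔻⁴) = {f ≤ 0}`
    rw [Set.range_comp, Set.range_comp, (EquivLike.surjective Φ.symm).range_eq, Set.image_univ,
      RegularSublevel.range_incl]
    ext x
    simp only [mem_image, mem_preimage, mem_Iic, mem_setOf_eq]
    constructor
    · rintro ⟨y, hy, rfl⟩
      exact ⟨hUΩ y y.2, hy⟩
    · rintro ⟨hx, hfx⟩
      exact ⟨⟨x, hKU x hx hfx⟩, hfx, rfl⟩
  · -- `j(𝕊³) = {f = 0}`: `Φ⁻¹` maps `∂𝔻⁴ = 𝕊³` onto `∂{g ≤ 0} = {g = 0}`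
    rw [Set.range_comp _ (Set.inclusion _), range_inclusion_eq_boundary, Set.image_comp,
      Set.image_comp, Diffeomorph.image_boundary (by simp) Φ.symm]
    ext x
    simp only [mem_image, mem_setOf_eq]
    constructor
    · rintro ⟨y, ⟨s, hs, rfl⟩, rfl⟩
      exact ⟨hUΩ _ (RegularSublevel.incl h s).2, (RegularSublevel.mem_boundary_iff h s).1 hs⟩
    · rintro ⟨hx, hfx⟩
      have hxU : x ∈ U := hKU x hx hfx.le
      refine ⟨⟨x, hxU⟩, ⟨RegularSublevel.mk h ⟨x, hxU⟩ hfx.le, ?_, rfl⟩, rfl⟩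
      exact (RegularSublevel.mem_boundary_iff h _).2 hfx

end BallOfSublevel

end Summit.SmoothPoincare4.SmoothPoincare4.Theorems.OrigamiRung.PairRigidityEndgame

end
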